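import Summits.ValiantsHypothesis.ValiantsHypothesis.Theorems.LacunarySymmetroidMatrixDescartesCensusIntervalParityVisits

/-!
# `MatrixDescartes` census — MONOTONE VISITS: the parity of the det-roots between zeros of two DIFFERENT node nomials

HONEST FRAMING.  Object-search cell `pub-symmetroid`, door-A seat `val-sym-door-p3` (g9); item stmt-ValiantsHypothesis-19980
`DoorA34 = PosRootLawAt 3 4 18` (route item `Theses.LacunarySymmetroid.DoorA34`) is OPEN and asserted nowhere in this file.
Companion of `…CensusIntervalParityVisits` (return visits are even).  For a node-frame pencil `S l = ∑ᵢ A i l • vᵢvᵢᵀ` in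
general position and `t₁ < t₂` with `ℓ_{j₁}(t₁) = 0`, `ℓ_{j₂}(t₂) = 0`, `j₁ ≠ j₂`, the two remaining node nomials zero-free on
`[t₁, t₂]` and `ℓ_{j₂}(t₁), ℓ_{j₁}(t₂) ≠ 0`:

* **`even_countP_roots_between_zeros_iff`** — the number of det-roots in `(t₁, t₂)` counted with multiplicity is EVEN iff
  `ℓ_{j₂}(t₁) · ℓ_{j₁}(t₂) > 0`.  Chamber reading (`…NodeChambers`): crossing the wall of `ℓ_{j₁}` DOWN (into one more negative
  node value) at `t₁` and the wall of `ℓ_{j₂}` DOWN at `t₂` is a MONOTONE visit `k−1 → k → k+1` — there `ℓ_{j₂}(t₁) > 0 > ℓ_{j₁}(t₂)`,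
  so the count is ODD; leaving by an UP wall after entering by a DOWN wall (or vice versa) gives the same sign, EVEN.

Nothing here bounds `ζ_sym(3,4)`; `DoorA34` stays OPEN; nothing bears on `MatrixDescartes` (stmt-ValiantsHypothesis-18050) or on
`VP ≠ VNP`.  [folklore] Bookkeeping over `det_walls_parity` + sign persistence.
-/

-- `Summit.ValiantsHypothesis.ValiantsHypothesis.…` repeats a component by the D-0017 layout
-- (single-conjunct summit), which the `dupNamespace` linter flags; the name is mandated.
set_option linter.dupNamespace false

namespace Summit.ValiantsHypothesis.ValiantsHypothesis.Theorems.LacunarySymmetroidMatrixDescartes.Census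

open Finset Polynomial
open scoped BigOperators Matrix Polynomial

/-- Values of the transpositions `swap j 3` on `0, 1, 2`. [folklore] -/
theorem swap_three_values :
    (Equiv.swap (0 : Fin 4) 3 0 = 3 ∧ Equiv.swap (0 : Fin 4) 3 1 = 1 ∧ Equiv.swap (0 : Fin 4) 3 2 = 2) ∧
    (Equiv.swap (1 : Fin 4) 3 0 = 0 ∧ Equiv.swap (1 : Fin 4) 3 1 = 3 ∧ Equiv.swap (1 : Fin 4) 3 2 = 2) ∧
    (Equiv.swap (2 : Fin 4) 3 0 = 0 ∧ Equiv.swap (2 : Fin 4) 3 1 = 1 ∧ Equiv.swap (2 : Fin 4) 3 2 = 3) ∧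
    (Equiv.swap (3 : Fin 4) 3 0 = 0 ∧ Equiv.swap (3 : Fin 4) 3 1 = 1 ∧ Equiv.swap (3 : Fin 4) 3 2 = 2) := by
  decide

/-- Positive-factor cancellation in a sign test. [folklore] -/
theorem pos_mul_iff_aux {x y c : ℝ} (hc : 0 < c) {P : ℝ} (hP : P = x * y * c) : (0 < P ↔ 0 < x * y) := by
  rw [hP]; exact mul_pos_iff_of_pos_right hc

/-- **MONOTONE VISITS.**  Between a zero `t₁` of `ℓ_{j₁}` and a zero `t₂ > t₁` of a DIFFERENT node nomial `ℓ_{j₂}`, with the two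
remaining node nomials zero-free on `[t₁, t₂]` and `ℓ_{j₂}(t₁) ≠ 0 ≠ ℓ_{j₁}(t₂)`, the number of det-roots of a general-position
node-frame pencil in `(t₁, t₂)` counted with multiplicity is even iff `ℓ_{j₂}(t₁) · ℓ_{j₁}(t₂) > 0`. [folklore] -/
theorem even_countP_roots_between_zeros_iff {K : ℕ} (d : Fin K → ℕ) (A : Fin 4 → Fin K → ℝ)
    (v : Fin 4 → Fin 3 → ℝ)
    (hgp : ∀ a b c : Fin 4, a ≠ b → b ≠ c → a ≠ c → (Matrix.of ![v a, v b, v c]).det ≠ 0)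
    {t₁ t₂ : ℝ} (ht : t₁ < t₂) (j₁ j₂ : Fin 4) (hj : j₁ ≠ j₂)
    (h₁ : ∑ l, A j₁ l * t₁ ^ d l = 0) (h₂ : ∑ l, A j₂ l * t₂ ^ d l = 0)
    (h₂₁ : ∑ l, A j₂ l * t₁ ^ d l ≠ 0) (h₁₂ : ∑ l, A j₁ l * t₂ ^ d l ≠ 0)
    (hother : ∀ i, i ≠ j₁ → i ≠ j₂ → ∀ t ∈ Set.Icc t₁ t₂, ∑ l, A i l * t ^ d l ≠ 0)
    (hP : (∑ l, (X : ℝ[X]) ^ d l • (∑ i, A i l • Matrix.vecMulVec (v i) (v i)).map C).det ≠ 0) :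
    Even ((∑ l, (X : ℝ[X]) ^ d l • (∑ i, A i l • Matrix.vecMulVec (v i) (v i)).map C).det.roots.countP
        (fun r => t₁ < r ∧ r < t₂)) ↔
      0 < (∑ l, A j₂ l * t₁ ^ d l) * (∑ l, A j₁ l * t₂ ^ d l) := by
  have hne₁ : ∀ i, i ≠ j₁ → ∑ l, A i l * t₁ ^ d l ≠ 0 := by
    intro i hi
    by_cases hi2 : i = j₂
    · rw [hi2]; exact h₂₁
    · exact hother i hi hi2 t₁ ⟨le_rfl, ht.le⟩
  have hne₂ : ∀ i, i ≠ j₂ → ∑ l, A i l * t₂ ^ d l ≠ 0 := by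
    intro i hi
    by_cases hi1 : i = j₁
    · rw [hi1]; exact h₁₂
    · exact hother i hi1 hi t₂ ⟨ht.le, le_rfl⟩
  have pers : ∀ i, i ≠ j₁ → i ≠ j₂ → 0 < (∑ l, A i l * t₁ ^ d l) * (∑ l, A i l * t₂ ^ d l) :=
    fun i hi1 hi2 => mul_pos_of_forall_ne_zero (continuous_nodeNomial d A i) ht (hother i hi1 hi2)
  rw [det_walls_parity d A v hgp ht j₁ j₂ h₁ hne₁ h₂ hne₂ hP]
  obtain ⟨⟨s00, s01, s02⟩, ⟨s10, s11, s12⟩, ⟨s20, s21, s22⟩, ⟨s30, s31, s32⟩⟩ := swap_three_values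
  have hj₁ : j₁ = 0 ∨ j₁ = 1 ∨ j₁ = 2 ∨ j₁ = 3 := by fin_cases j₁ <;> decide
  have hj₂ : j₂ = 0 ∨ j₂ = 1 ∨ j₂ = 2 ∨ j₂ = 3 := by fin_cases j₂ <;> decide
  rcases hj₁ with rfl | rfl | rfl | rfl <;> rcases hj₂ with rfl | rfl | rfl | rfl
  all_goals (first | exact absurd rfl hj | skip)
  · -- j₁ = 0, j₂ = 1: other nodes 2, 3
    simp only [s00, s01, s02, s10, s11, s12]
    have hc := mul_pos (pers 2 (by decide) (by decide)) (pers 3 (by decide) (by decide))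
    exact pos_mul_iff_aux hc (by ring)
  · -- j₁ = 0, j₂ = 2: other nodes 1, 3
    simp only [s00, s01, s02, s20, s21, s22]
    have hc := mul_pos (pers 1 (by decide) (by decide)) (pers 3 (by decide) (by decide))
    exact pos_mul_iff_aux hc (by ring)
  · -- j₁ = 0, j₂ = 3: other nodes 1, 2
    simp only [s00, s01, s02, s30, s31, s32]
    have hc := mul_pos (pers 1 (by decide) (by decide)) (pers 2 (by decide) (by decide))
    exact pos_mul_iff_aux hc (by ring)
  · -- j₁ = 1, j₂ = 0: other nodes 2, 3
    simp only [s10, s11, s12, s00, s01, s02]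
    have hc := mul_pos (pers 2 (by decide) (by decide)) (pers 3 (by decide) (by decide))
    exact pos_mul_iff_aux hc (by ring)
  · -- j₁ = 1, j₂ = 2: other nodes 0, 3
    simp only [s10, s11, s12, s20, s21, s22]
    have hc := mul_pos (pers 0 (by decide) (by decide)) (pers 3 (by decide) (by decide))
    exact pos_mul_iff_aux hc (by ring)
  · -- j₁ = 1, j₂ = 3: other nodes 0, 2
    simp only [s10, s11, s12, s30, s31, s32]
    have hc := mul_pos (pers 0 (by decide) (by decide)) (pers 2 (by decide) (by decide))
    exact pos_mul_iff_aux hc (by ring)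
  · -- j₁ = 2, j₂ = 0: other nodes 1, 3
    simp only [s20, s21, s22, s00, s01, s02]
    have hc := mul_pos (pers 1 (by decide) (by decide)) (pers 3 (by decide) (by decide))
    exact pos_mul_iff_aux hc (by ring)
  · -- j₁ = 2, j₂ = 1: other nodes 0, 3
    simp only [s20, s21, s22, s10, s11, s12]
    have hc := mul_pos (pers 0 (by decide) (by decide)) (pers 3 (by decide) (by decide))
    exact pos_mul_iff_aux hc (by ring)
  · -- j₁ = 2, j₂ = 3: other nodes 0, 1
    simp only [s20, s21, s22, s30, s31, s32]
    have hc := mul_pos (pers 0 (by decide) (by decide)) (pers 1 (by decide) (by decide))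
    exact pos_mul_iff_aux hc (by ring)
  · -- j₁ = 3, j₂ = 0: other nodes 1, 2
    simp only [s30, s31, s32, s00, s01, s02]
    have hc := mul_pos (pers 1 (by decide) (by decide)) (pers 2 (by decide) (by decide))
    exact pos_mul_iff_aux hc (by ring)
  · -- j₁ = 3, j₂ = 1: other nodes 0, 2
    simp only [s30, s31, s32, s10, s11, s12]
    have hc := mul_pos (pers 0 (by decide) (by decide)) (pers 2 (by decide) (by decide))
    exact pos_mul_iff_aux hc (by ring)
  · -- j₁ = 3, j₂ = 2: other nodes 0, 1
    simp only [s30, s31, s32, s20, s21, s22]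
    have hc := mul_pos (pers 0 (by decide) (by decide)) (pers 1 (by decide) (by decide))
    exact pos_mul_iff_aux hc (by ring)

end Summit.ValiantsHypothesis.ValiantsHypothesis.Theorems.LacunarySymmetroidMatrixDescartes.Census
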